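import Mathlib.Analysis.Fourier.FourierTransform
import Literature.Analysis.FluidPDE.TaoAveragedEuler
import Literature.Analysis.FluidPDE.IsometryInvariance
import HarnessLib

/-!
# Route OddMorawetz — `MorawetzKillsTypeI`, isometry covariance of the Euler bilinear operator
(item stmt-NavierStokesRegularity-1377, stub `stub_rotate_eulerBilinear`)

For a linear isometry `R` of `ℝ³` and the push-forward `R·v (x) := R (v (R⁻¹ x))` of a vector
field, Tao's exact Euler bilinear operator `B(u,v) = −½ P_L[(u·∇)v + (v·∇)u]`
(`Literature.Analysis.FluidPDE.eulerBilinear`, Tao 2016, (1.8), `P_L` the function-level Leray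
projector `lerayProjFun`) is covariant: `B(R·v, R·v) = R·B(v, v)` for EVERY field `v : ℝ³ → ℝ³`.

No regularity or integrability is assumed: every step is a symmetry of (Bochner) integrals or of
`fderiv`, valid with their junk conventions.
* `convect (R·v) (R·v) x = R (convect v v (R⁻¹ x))` (tree, `convect_conj_linearIsometryEquiv`);
* the value-side action: `R y = M y` for the orthogonal matrix `M` of `R` in the standard basis
  (`exists_matrix`), and `M` acts `ℂ`-linearly and invertibly on `ℂ^ι`, so it commutes with Bochner
  integrals unconditionally (`ContinuousLinearEquiv.integral_comp_comm`), hence with `𝓕`, `𝓕⁻`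
  (`fourier_conj`, `fourierInv_conj`, using `Real.fourier_comp_linearIsometry` on the argument
  side);
* the complexified Leray symbol satisfies `P̂(R η) (M c) = M (P̂(η) c)` (`leraySymbolC_conj`), since
  `ξ · c` and `‖ξ‖` are `O(ι)`-invariant (`Mᵀ M = 1`);
* `realPart ∘ M = M ∘ realPart` and `complexify ∘ M = M ∘ complexify` (`M` is real).
This generalises the landed reflection case `R = −1` (`stub_reflect_eulerBilinear`).
-/

noncomputable section

-- the route's Theorems namespace repeats the summit name by design (Summit.<S>.<P>.Theorems, S = P)
set_option linter.dupNamespace false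

open MeasureTheory FourierTransform
open scoped RealInnerProductSpace Matrix

namespace Summit.NavierStokesRegularity.NavierStokesRegularity.Theorems

open Literature.Analysis.FluidPDE Literature.Analysis.FunctionSpaces

namespace RotateEulerBilinear

variable {ι : Type*} [Fintype ι] [DecidableEq ι]

section MatrixAction

/-- **An invertible complex matrix acting on `ℂ^ι` commutes with Bochner integrals,
unconditionally**: `∫ A φ = A ∫ φ` (both sides are junk `0` together). Packaged through the
continuous linear equivalence `Matrix.toLpLin 2 2 A` with inverse `Matrix.toLpLin 2 2 B`. -/
theorem integral_toLp_mulVec_comm {A B : Matrix ι ι ℂ} (hAB : A * B = 1) (hBA : B * A = 1)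
    {X : Type*} [MeasurableSpace X] (μ : Measure X) (φ : X → EuclideanSpace ℂ ι) :
    ∫ x, (WithLp.toLp 2 (A *ᵥ WithLp.ofLp (φ x)) : EuclideanSpace ℂ ι) ∂μ =
      WithLp.toLp 2 (A *ᵥ WithLp.ofLp (∫ x, φ x ∂μ)) := by
  let L : EuclideanSpace ℂ ι ≃ₗ[ℂ] EuclideanSpace ℂ ι :=
    LinearEquiv.ofLinear (Matrix.toLpLin 2 2 A) (Matrix.toLpLin 2 2 B)
      (by rw [← Matrix.toLpLin_mul_same, hAB, Matrix.toLpLin_one])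
      (by rw [← Matrix.toLpLin_mul_same, hBA, Matrix.toLpLin_one])
  exact L.toContinuousLinearEquiv.integral_comp_comm φ

variable {V : Type*} [NormedAddCommGroup V] [InnerProductSpace ℝ V] [MeasurableSpace V]
  [BorelSpace V] [FiniteDimensional ℝ V]

/-- **The Fourier transform commutes with the conjugation `f ↦ A ∘ f ∘ Φ`** by an invertible complex
matrix `A` on the values and a linear isometry `Φ` on the argument:
`𝓕 (x ↦ A f(Φ x)) ξ = A (𝓕 f)(Φ ξ)`, for EVERY `f` (`Real.fourier_comp_linearIsometry` and
`integral_toLp_mulVec_comm` are unconditional). -/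
theorem fourier_conj {A B : Matrix ι ι ℂ} (hAB : A * B = 1) (hBA : B * A = 1) (Φ : V ≃ₗᵢ[ℝ] V)
    (f : V → EuclideanSpace ℂ ι) (ξ : V) :
    𝓕 (fun x => (WithLp.toLp 2 (A *ᵥ WithLp.ofLp (f (Φ x))) : EuclideanSpace ℂ ι)) ξ =
      WithLp.toLp 2 (A *ᵥ WithLp.ofLp (𝓕 f (Φ ξ))) := by
  have h := Real.fourier_comp_linearIsometry Φ
    (fun y => (WithLp.toLp 2 (A *ᵥ WithLp.ofLp (f y)) : EuclideanSpace ℂ ι)) ξ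
  rw [show (fun x => (WithLp.toLp 2 (A *ᵥ WithLp.ofLp (f (Φ x))) : EuclideanSpace ℂ ι)) =
      (fun y => (WithLp.toLp 2 (A *ᵥ WithLp.ofLp (f y)) : EuclideanSpace ℂ ι)) ∘ Φ from rfl, h]
  simp only [Real.fourier_eq]
  rw [← integral_toLp_mulVec_comm hAB hBA]
  congr 1
  funext v
  rw [Circle.smul_def, Circle.smul_def, WithLp.ofLp_smul, Matrix.mulVec_smul, WithLp.toLp_smul]

/-- **The inverse Fourier transform commutes with the conjugation `F ↦ A ∘ F ∘ Φ`**: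
`𝓕⁻ (ξ ↦ A F(Φ ξ)) x = A (𝓕⁻ F)(Φ x)`, for EVERY `F` (as `fourier_conj`, with
`Real.fourierInv_comp_linearIsometry`). -/
theorem fourierInv_conj {A B : Matrix ι ι ℂ} (hAB : A * B = 1) (hBA : B * A = 1) (Φ : V ≃ₗᵢ[ℝ] V)
    (F : V → EuclideanSpace ℂ ι) (x : V) :
    𝓕⁻ (fun ξ => (WithLp.toLp 2 (A *ᵥ WithLp.ofLp (F (Φ ξ))) : EuclideanSpace ℂ ι)) x =
      WithLp.toLp 2 (A *ᵥ WithLp.ofLp (𝓕⁻ F (Φ x))) := by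
  have h := Real.fourierInv_comp_linearIsometry Φ
    (fun η => (WithLp.toLp 2 (A *ᵥ WithLp.ofLp (F η)) : EuclideanSpace ℂ ι)) x
  rw [show (fun ξ => (WithLp.toLp 2 (A *ᵥ WithLp.ofLp (F (Φ ξ))) : EuclideanSpace ℂ ι)) =
      (fun η => (WithLp.toLp 2 (A *ᵥ WithLp.ofLp (F η)) : EuclideanSpace ℂ ι)) ∘ Φ from rfl, h]
  simp only [Real.fourierInv_eq]
  rw [← integral_toLp_mulVec_comm hAB hBA]
  congr 1
  funext v
  rw [Circle.smul_def, Circle.smul_def, WithLp.ofLp_smul, Matrix.mulVec_smul, WithLp.toLp_smul]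

end MatrixAction

section RealMatrix

/-- Complexifying an identity `A * B = 1` of real matrices. -/
theorem map_ofReal_mul_eq_one {A B : Matrix ι ι ℝ} (h : A * B = 1) :
    A.map ((↑) : ℝ → ℂ) * B.map ((↑) : ℝ → ℂ) = 1 := by
  have h' : Complex.ofRealHom.mapMatrix (A * B) = 1 := by rw [h, map_one]
  rwa [map_mul, RingHom.mapMatrix_apply, RingHom.mapMatrix_apply] at h'

omit [DecidableEq ι] in
/-- **A real matrix commutes with complexification**: `complexify (M y) = M (complexify y)`. -/
theorem complexify_toLp_mulVec (M : Matrix ι ι ℝ) (y : EuclideanSpace ℝ ι) :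
    EuclideanSpace.complexify (WithLp.toLp 2 (M *ᵥ WithLp.ofLp y)) =
      WithLp.toLp 2 (M.map ((↑) : ℝ → ℂ) *ᵥ WithLp.ofLp (EuclideanSpace.complexify y)) := by
  ext i
  simp [Matrix.mulVec, dotProduct]

omit [DecidableEq ι] in
/-- **A real matrix commutes with the coordinatewise real part**: `Re (M w) = M (Re w)`. -/
theorem realPart_toLp_mulVec (M : Matrix ι ι ℝ) (w : EuclideanSpace ℂ ι) :
    realPart (WithLp.toLp 2 (M.map ((↑) : ℝ → ℂ) *ᵥ WithLp.ofLp w)) =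
      WithLp.toLp 2 (M *ᵥ WithLp.ofLp (realPart w)) := by
  ext i
  simp [Matrix.mulVec, dotProduct, Complex.re_sum]

/-- **A complex-orthogonal matrix preserves the bilinear pairing** `a · c = ∑ i, a i * c i`:
`(A a) · (A c) = a · c` when `Aᵀ A = 1`. -/
theorem dotProduct_mulVec_mulVec {A : Matrix ι ι ℂ} (hA : Aᵀ * A = 1) (a c : ι → ℂ) :
    (A *ᵥ a) ⬝ᵥ (A *ᵥ c) = a ⬝ᵥ c := by
  rw [← Matrix.vecMul_transpose A a, ← Matrix.dotProduct_mulVec a Aᵀ (A *ᵥ c),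
    Matrix.mulVec_mulVec, hA, Matrix.one_mulVec]

/-- **The complexified Leray symbol is `O(ι)`-covariant**: if the linear isometry `R` acts through
the orthogonal matrix `M` (`R y = M y`, `Mᵀ M = 1`), then `P̂(R η) (M c) = M (P̂(η) c)` for the
symbol `P̂(ξ) c = c − (ξ·c/|ξ|²) ξ` (`ξ · c` and `‖ξ‖` are invariant, `ξ ↦ M ξ` is linear). -/
theorem leraySymbolC_conj (R : EuclideanSpace ℝ ι ≃ₗᵢ[ℝ] EuclideanSpace ℝ ι) {M : Matrix ι ι ℝ}
    (hR : ∀ y, R y = WithLp.toLp 2 (M *ᵥ WithLp.ofLp y)) (hM : Mᵀ * M = 1)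
    (η : EuclideanSpace ℝ ι) (c : EuclideanSpace ℂ ι) :
    leraySymbolC (R η) (WithLp.toLp 2 (M.map ((↑) : ℝ → ℂ) *ᵥ WithLp.ofLp c)) =
      WithLp.toLp 2 (M.map ((↑) : ℝ → ℂ) *ᵥ WithLp.ofLp (leraySymbolC η c)) := by
  have hC : (M.map ((↑) : ℝ → ℂ))ᵀ * M.map ((↑) : ℝ → ℂ) = 1 := by
    have h := map_ofReal_mul_eq_one hM
    rwa [Matrix.transpose_map] at h
  have hη : EuclideanSpace.complexify (R η) =
      WithLp.toLp 2 (M.map ((↑) : ℝ → ℂ) *ᵥ WithLp.ofLp (EuclideanSpace.complexify η)) := by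
    rw [hR, complexify_toLp_mulVec]
  have hdot : ∑ i, ((R η) i : ℂ) * (WithLp.toLp 2 (M.map ((↑) : ℝ → ℂ) *ᵥ WithLp.ofLp c) :
      EuclideanSpace ℂ ι) i = ∑ i, (η i : ℂ) * c i := by
    have key := dotProduct_mulVec_mulVec hC (WithLp.ofLp (EuclideanSpace.complexify η))
      (WithLp.ofLp c)
    have hi : ∀ i, ((R η) i : ℂ) =
        (M.map ((↑) : ℝ → ℂ) *ᵥ WithLp.ofLp (EuclideanSpace.complexify η)) i := fun i => by
      rw [← EuclideanSpace.complexify_apply, hη, PiLp.toLp_apply]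
    simp only [hi]
    exact key
  unfold leraySymbolC
  rw [LinearIsometryEquiv.norm_map, hdot, hη]
  simp only [WithLp.ofLp_sub, WithLp.ofLp_smul, Matrix.mulVec_sub, Matrix.mulVec_smul,
    WithLp.toLp_sub, WithLp.toLp_smul]

/-- **Every linear isometry of `ℝ^ι` acts through an orthogonal matrix**: there is `M` with
`Mᵀ M = M Mᵀ = 1` and `R y = M y` for all `y` (the matrix of `R` in the standard orthonormal basis,
`OrthonormalBasis.toMatrix_orthonormalBasis_conjTranspose_mul_self`). -/
theorem exists_matrix (R : EuclideanSpace ℝ ι ≃ₗᵢ[ℝ] EuclideanSpace ℝ ι) :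
    ∃ M : Matrix ι ι ℝ, Mᵀ * M = 1 ∧ M * Mᵀ = 1 ∧
      ∀ y, R y = WithLp.toLp 2 (M *ᵥ WithLp.ofLp y) := by
  refine ⟨(EuclideanSpace.basisFun ι ℝ).toBasis.toMatrix ((EuclideanSpace.basisFun ι ℝ).map R),
    ?_, ?_, fun y => ?_⟩
  · simpa only [Matrix.conjTranspose_eq_transpose_of_trivial] using
      (EuclideanSpace.basisFun ι ℝ).toMatrix_orthonormalBasis_conjTranspose_mul_self
        ((EuclideanSpace.basisFun ι ℝ).map R)
  · simpa only [Matrix.conjTranspose_eq_transpose_of_trivial] using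
      (EuclideanSpace.basisFun ι ℝ).toMatrix_orthonormalBasis_self_mul_conjTranspose
        ((EuclideanSpace.basisFun ι ℝ).map R)
  · have h := Module.Basis.toMatrix_mulVec_repr ((EuclideanSpace.basisFun ι ℝ).map R).toBasis
      (EuclideanSpace.basisFun ι ℝ).toBasis (R y)
    have e1 : (⇑(((EuclideanSpace.basisFun ι ℝ).map R).toBasis.repr (R y)) : ι → ℝ) =
        WithLp.ofLp y := by
      funext i
      rw [OrthonormalBasis.coe_toBasis_repr_apply]
      change (EuclideanSpace.basisFun ι ℝ).repr (R.symm (R y)) i = _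
      rw [LinearIsometryEquiv.symm_apply_apply]
      rfl
    have e2 : (⇑((EuclideanSpace.basisFun ι ℝ).toBasis.repr (R y)) : ι → ℝ) =
        WithLp.ofLp (R y) := by
      funext i
      rw [OrthonormalBasis.coe_toBasis_repr_apply]
      rfl
    rw [OrthonormalBasis.coe_toBasis, e1, e2] at h
    rw [h]

/-- **Isometry covariance of the function-level Leray projector**: `P_L (R·g) = R·(P_L g)` for
EVERY real field `g`, i.e. `lerayProjFun (x ↦ R g(R⁻¹x)) = x ↦ R (lerayProjFun g)(R⁻¹ x)`
(unconditional), given the orthogonal matrix `M` of `R`. -/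
theorem lerayProjFun_conj (R : EuclideanSpace ℝ ι ≃ₗᵢ[ℝ] EuclideanSpace ℝ ι) {M : Matrix ι ι ℝ}
    (hR : ∀ y, R y = WithLp.toLp 2 (M *ᵥ WithLp.ofLp y)) (hM : Mᵀ * M = 1) (hM' : M * Mᵀ = 1)
    (g : EuclideanSpace ℝ ι → EuclideanSpace ℝ ι) :
    lerayProjFun (fun x => R (g (R.symm x))) = fun x => R (lerayProjFun g (R.symm x)) := by
  have hC : (M.map ((↑) : ℝ → ℂ))ᵀ * M.map ((↑) : ℝ → ℂ) = 1 := by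
    have h := map_ofReal_mul_eq_one hM
    rwa [Matrix.transpose_map] at h
  have hC' : M.map ((↑) : ℝ → ℂ) * (M.map ((↑) : ℝ → ℂ))ᵀ = 1 := by
    have h := map_ofReal_mul_eq_one hM'
    rwa [Matrix.transpose_map] at h
  -- the Fourier transform of the pushed-forward field
  have h1 : fourierVec (fun x => R (g (R.symm x))) = fun ξ =>
      WithLp.toLp 2 (M.map ((↑) : ℝ → ℂ) *ᵥ WithLp.ofLp (fourierVec g (R.symm ξ))) := by
    funext ξ
    unfold fourierVec
    have hc : (EuclideanSpace.complexify ∘ fun x => R (g (R.symm x))) = fun x =>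
        (WithLp.toLp 2 (M.map ((↑) : ℝ → ℂ) *ᵥ
          WithLp.ofLp ((EuclideanSpace.complexify ∘ g) (R.symm x))) : EuclideanSpace ℂ ι) := by
      funext x
      simp only [Function.comp_apply]
      rw [hR, complexify_toLp_mulVec]
    rw [hc, fourier_conj hC' hC R.symm (EuclideanSpace.complexify ∘ g) ξ]
  -- the Fourier-side integrand of the pushed-forward field
  have h2 : (fun ξ => leraySymbolC ξ (fourierVec (fun x => R (g (R.symm x))) ξ)) = fun ξ =>
      (WithLp.toLp 2 (M.map ((↑) : ℝ → ℂ) *ᵥ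
        WithLp.ofLp ((fun η => leraySymbolC η (fourierVec g η)) (R.symm ξ))) :
          EuclideanSpace ℂ ι) := by
    funext ξ
    rw [h1]
    have e := leraySymbolC_conj R hR hM (R.symm ξ) (fourierVec g (R.symm ξ))
    rw [LinearIsometryEquiv.apply_symm_apply] at e
    exact e
  funext x
  unfold lerayProjFun
  rw [h2, fourierInv_conj hC' hC R.symm (fun η => leraySymbolC η (fourierVec g η)) x,
    realPart_toLp_mulVec, ← hR]

end RealMatrix

end RotateEulerBilinear

open RotateEulerBilinear in
/-- **Isometry covariance of the Euler bilinear operator** (item stmt-NavierStokesRegularity-1377,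
route OddMorawetz, stub `stub_rotate_eulerBilinear`): for every linear isometry `R` of `ℝ³`, the
push-forward `R·v (x) := R (v (R⁻¹ x))` and Tao's exact Leray-projected nonlinearity
`B = eulerBilinear` (Tao 2016, (1.8)), `B(R·v, R·v) = R·B(v, v)` for EVERY `v : ℝ³ → ℝ³` — no
regularity is assumed, the identity holds through the Bochner/`fderiv` junk conventions since every
step is a symmetry (`convect_conj_linearIsometryEquiv`, `lerayProjFun_conj`). -/
theorem stub_rotate_eulerBilinear :
    ∀ (R : EuclideanSpace ℝ (Fin 3) ≃ₗᵢ[ℝ] EuclideanSpace ℝ (Fin 3)) (v : EuclideanSpace ℝ (Fin 3) → EuclideanSpace ℝ (Fin 3)),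
      Literature.Analysis.FluidPDE.eulerBilinear (fun x => R (v (R.symm x))) (fun x => R (v (R.symm x))) =
        fun x => R (Literature.Analysis.FluidPDE.eulerBilinear v v (R.symm x)) := by
  intro R v
  obtain ⟨M, hM, hM', hR⟩ := exists_matrix R
  unfold eulerBilinear
  have hg : (fun x => convect (fun x => R (v (R.symm x))) (fun x => R (v (R.symm x))) x +
        convect (fun x => R (v (R.symm x))) (fun x => R (v (R.symm x))) x) =
      fun x => R ((fun y => convect v v y + convect v v y) (R.symm x)) := by
    funext x
    rw [convect_conj_linearIsometryEquiv, ← map_add]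
  rw [hg, lerayProjFun_conj R hR hM hM' (fun y => convect v v y + convect v v y)]
  funext x
  simp only [Pi.smul_apply, LinearIsometryEquiv.map_smul]

end Summit.NavierStokesRegularity.NavierStokesRegularity.Theorems

end
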